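import Literature.NumberTheory.DiophantineGeometry.SchurWeylPlethysmKroneckerBoundProofs
import Literature.Computability.AlgebraicComplexity.MS2001StableObstructionFirstCriterion
import Literature.Computability.AlgebraicComplexity.SLOrbitQuotientHolds
import Literature.Computability.AlgebraicComplexity.OccurrenceObstructionWeights
import Literature.Computability.AlgebraicComplexity.CoordRepRational
import Literature.Computability.AlgebraicComplexity.PerDetHwvCertificateThirteenThirteen
import Literature.Computability.AlgebraicComplexity.BLMW11PerOrbitCeiling
import Literature.Computability.AlgebraicComplexity.BI17DetPerMinimalDegreeProofs
import Literature.RepresentationTheory.FiniteGroups.SymmetricGroupCharacterEvaluation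
import HarnessLib

/-!
# Kronecker-vanishing occurrence obstructions are first-criterion modules (GCT I, Thm. 5.1)

Topic `Literature/Computability/AlgebraicComplexity` (geometric complexity theory); proofs file
(THEOREMS ONLY: no definition, no named fact; D-0026). Companion of
`MS2001StableObstructionFirstCriterion.lean` (GCT I Thm. 5.1, first criterion, over `ℂ`) and of
`Literature/NumberTheory/DiophantineGeometry/SchurWeylPlethysmKroneckerBoundProofs.lean` (BLMW's
Kronecker bound `mult_{λ*} k[Δ(det_m)] ≤ g(λ, m × d, m × d)`).

## What is proved

Mulmuley–Sohoni, *GCT I* (SIAM J. Comput. 31 (2001)), Thm. 5.1 (authors' version p. 20): «Let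
`H ⊆ G` be the stabilizer of `f`, and `Q ⊆ G` the stabilizer of `g`. Suppose `f` is stable. Then a
representation `W` of `G` is an obstruction for the pair `(f, g)` if `W` contains a trivial
`H`-submodule but not a trivial `Q`-submodule» (FIRST CRITERION; `G = SL`). After their Ex. 5.2.1
(AV p. 22) the authors write, for the pair (permanent, determinant): «It would be interesting to
construct a representation `W`, for each `d`, such that `W` contains a trivial `H`-representation
but not a trivial `Q`-representation.» This file shows that EVERY occurrence of a highest weight
`λ*` in the coordinate ring `k[Δ_m(h)]` of the orbit closure of a form `h` of degree `m` on the
matrix space `k^{m × m}` whose rectangular Kronecker coefficient `g(λ, m × d, m × d)` VANISHES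
yields such a module for the pair `(h, det_m)`: the dual `W^*` of the `GL_{m²}`-span `W` of a
highest-weight vector of weight `λ*`.

* `boundSpace_ne_bot_of_invariant_functional` (§2, the heart, any form `f` on `k^σ`, characteristic
  zero): if `x ∈ k[Δ_m(f)]` is a `B`-semi-invariant of weight `χ` (`∑ χ = -D`) and `θ` is a linear
  functional on `k[Δ_m(f)]`, not identically zero on the orbit `GL·x` and invariant on it under a
  subgroup `K` containing a family `S` (reindexed along `e : Fin N ≃o σ`) whose common fixed vectors
  in `(k^N)^{⊗D}` lie in `X`, then BLMW's bound space `boundSpace (χ ∘ e) X` is non-zero. The matrix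
  coefficient `P(g) = θ(g⁻¹ · x)` is a polynomial in `g` (`exists_apply_coordSubst_eq_eval_inv`),
  left `B`-semi-invariant of weight `χ` (`x` is a highest-weight vector), right `K`-invariant
  (`θ` is), homogeneous of degree `D` (scalars), hence `P = pairPoly L` with `L` in the bound space
  (`exists_mem_boundSpace`); `L = 0` would force `θ = 0` on `GL·x`. This is the argument of
  `finrank_highestWeightSpace_orbitCoordRep_le` with BLMW's evaluation «restriction to the orbit
  `GL·det`» replaced by an ARBITRARY invariant functional — the right invariance now comes from
  `θ`, not from the point `f`, so `f` and the stabilised form may differ.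
* `finrank_boundSpace_kronInvariants_eq_kroneckerCoeff` (§3): for `λ ⊢ m·d` with at most `m²`
  parts, `dim boundSpace λ* (kronInvariants) = g(λ, m × d, m × d)` (the count inside
  `orbitMultiplicity_det_le_kroneckerCoeff_holds`, stated on its own).
* `kroneckerCoeff_pos_of_detStabilizerInvariant_functional`,
  `kroneckerCoeff_pos_of_isDualAdmissible_detStabilizer` (§3–§4): a non-zero functional on the
  `GL_{m²}`-span `W` of a highest-weight vector of weight `λ*` in `k[Δ_m(f)]` (ANY form `f` on
  `k^{m×m}`) invariant under `SL_{m²} ∩ Stab(det_m)` forces `g(λ, m × d, m × d) > 0`; the Borel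
  pairs `a ⊗ b` (`a, b` upper triangular unimodular) lie in `SL_{m²} ∩ Stab(det_m)`
  (`reindexGL_kronFin_mem_slSubgroup_inf_linStabilizer_detFormLex`). Contrapositives
  `not_isDualAdmissible_detStabilizer_of_kroneckerCoeff_eq_zero`,
  `not_isAdmissible_dual_detStabilizer_of_kroneckerCoeff_eq_zero`.
* `exists_firstCriterionModule_of_kroneckerCoeff_eq_zero` (§5, algebraically closed `k` of
  characteristic zero): `h` a form of degree `m ≠ 0` on `k^{m×m}`, `0 < mult_{λ*} k[Δ_m(h)]`,
  `g(λ, m × d, m × d) = 0` ⇒ there is an irreducible `GL_{m²}`-subrepresentation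
  `W ≤ k[Δ_m(h)]_d` with `W^*` admissible for `SL ∩ Stab(h)` (Mulmuley–Sohoni 2008 Prop. 4.2:
  evaluation at `ĥ`, tree theorem `isDualAdmissible_stabilizer_of_subrepresentation`) and NOT
  admissible for `SL ∩ Stab(det_m)`. With GCT I Thm. 5.1 (first criterion, over `ℂ`, tree theorem
  `isAdmissible_stabilizer_of_mem_orbitClosure_of_orbitQuotient` fed with
  `Grosshans1997_thm_1_11_slOrbit_forms_holds`): `h` polystable ⇒ `h ∉ Δ(det_m)`
  (`not_mem_orbitClosure_detFormLex_of_kroneckerCoeff_eq_zero`).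
* §6, the instance `d = 3` of MS's invitation, MODULO ONE CLASS SUM: `λ = (13,13,2,2,2,2,2) ⊢ 36`
  is the partition of Bürgisser–Ikenmeyer 2013 §4.6 (printed there as a type occurring in the
  vanishing IDEAL `I(Δ(det₃))₁₂`, via `a_λ(12[3]) > sk(λ, 3 × 12)`; the paper says nothing about
  `per₃`); its occurrence in `ℂ[Δ(per₃)]₁₂` is the tree's kernel certificate `cert1313_bound` of
  `PerDetHwvCertificateThirteenThirteen.lean` (`1 ≤ mult_{λ*}`, cell `pub-gct`); GIVEN
  `g(λ, (12,12,12), (12,12,12)) = 0` (hypothesis `hk`; the tree's kernel certificates give the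
  SYMMETRIC Kronecker coefficient `sk = 0`, not `g`; a numerical Murnaghan–Nakayama evaluation gives
  `g = 0`, no kernel certificate is in the tree), the span of that vector is a first-criterion
  module for `(per₃, det₃)` (`per3Det3_firstCriterionModule_of_kroneckerCoeff_eq_zero`) and
  `per₃ ∉ Δ(det₃)` follows BY THE FIRST CRITERION
  (`paddedPerFormLex_three_not_mem_orbitClosure_detFormLex_of_kroneckerCoeff_eq_zero`). The
  separation itself is classical (`dc(per₃) ≥ 5`); the content is the module.

* §7 (v2, the MULTIPLICITY form of the `Q`-side):
  `finrank_subgroupInvariants_dual_le_finrank_boundSpace` — for the span `W` of a highest-weight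
  vector and a subgroup `K` containing the family `S`,
  `dim (W^*)^K ≤ dim boundSpace (χ ∘ e) X` (the orbit coefficients `φ ↦ (g ↦ φ(g·x))` inject
  `(W^*)^K` into the evaluations of `pairPoly (boundSpace)`; witnesses from
  `exists_mem_boundSpace_of_invariant_functional`); for the determinant,
  `finrank_subgroupInvariants_dual_detStabilizer_le_kroneckerCoeff`:
  `dim (W^*)^{SL_{m²} ∩ Stab(det_m)} ≤ g(λ, m × d, m × d)`.
* §8 (v3, the residual number in the evaluator's currency):
  `kroneckerCoeff_cert1313_eq_zero_iff_kronSum_eq_zero` —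
  `g(λ, (12,12,12), (12,12,12)) = 0 ↔ MNEval.kronSum 36 [13,13,2,2,2,2,2] [12,12,12] [12,12,12] = 0`
  (`factorial_mul_kroneckerCoeff_eq_kronSum`, the tree's verified Murnaghan–Nakayama class sum), so
  that a kernel certificate of that ONE closed integer identity (the `Ex55`/`Ex56` chunk pattern of
  `BI17Ex55KroneckerChunks36*.lean`) makes §6 unconditional:
  `per3Det3_firstCriterionModule_of_kronSum_eq_zero`,
  `paddedPerFormLex_three_not_mem_orbitClosure_detFormLex_of_kronSum_eq_zero`.

Why `g` and not `sk`: `SL_{m²} ∩ Stab(det_m)` contains the Borel pairs `a ⊗ b` but (for odd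
`m(m-1)/2`, e.g. `m = 3`) not the transposition `X ↦ Xᵀ` (determinant `-1` on `k^{m×m}`), and the
bound space counts invariants of the Borel pairs only: `dim = g(λ, □, □)` (BLMW 2011 §5.2, proof of
Prop. 5.2.1: «To have a trivial `SL(E) × SL(F)` action on `S_μE ⊗ S_νF`, we need `μ = ν = (δ^n)`»).

Honest framing (cell `val-lit`, rung V3; row MS2001-A): a re-aiming of PROVED tree machinery;
`(per₃, det₃)` is a trivially known separation and the `d = 3` module is conditional on the number
`hk`; nothing here bears on VP versus VNP.

## References

* K. D. Mulmuley, M. Sohoni, *Geometric complexity theory I: an approach to the P vs. NP and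
  related problems*, SIAM J. Comput. 31 (2001) 496–526: Thm. 5.1 and §5.2 after Ex. 5.2.1
  (authors' version pp. 20–22). [MulmuleySohoniSIAM2001]
* K. D. Mulmuley, M. Sohoni, *Geometric complexity theory II*, SIAM J. Comput. 38 (2008),
  Prop. 4.2 (arXiv cs/0612134 Prop. 5.2). [MulmuleySohoniGCT2SIAM2008]
* P. Bürgisser, J. M. Landsberg, L. Manivel, J. Weyman, *An overview of mathematical issues arising
  in the geometric complexity theory approach to VP ≠ VNP*, SIAM J. Comput. 40 (2011), §5.2
  Prop. 5.2.1. [BLMW2011]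
* P. Bürgisser, C. Ikenmeyer, *Explicit lower bounds via geometric complexity theory*, STOC 2013
  = arXiv:1210.8368, §4.6 (`(13,13,2,2,2,2,2) ⊢_7 36` in degree `12`). [BurgisserIkenmeyer2013]
* F. D. Grosshans, *Algebraic Homogeneous Spaces and Invariant Theory*, LNM 1673 (1997), Thm. 1.11.
  [Grosshans1997]
* W. Fulton, J. Harris, *Representation Theory. A First Course*, GTM 129 (1991), Exercise 4.51
  (the character formula for Kronecker coefficients). [FultonHarrisGTM129]

## Provenance

Cell `val-lit`, seat `val-lit-t01` generation 6 (row MS2001-A, §5.2.1). Lean 4 + Mathlib, no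
`sorry`, no new axioms.
-/

noncomputable section

open MvPolynomial Representation
open scoped BigOperators Matrix Kronecker

namespace Literature.Computability.AlgebraicComplexity

open Literature.NumberTheory.DiophantineGeometry

/-! ### §1 Bookkeeping: invariants of `W^*` are invariant functionals -/

section Bookkeeping

variable {k : Type*} [Field k] {G : Type*} [Group G] {V : Type*} [AddCommGroup V] [Module k V]

/-- A non-zero `H`-invariant vector of the dual representation `W^*` is a non-zero `H`-invariant
functional on `W` (Mulmuley–Sohoni 2008 Def. 4.1, last clause: «`M` is `H`-admissible if `M^*`
contains an `H`-invariant»); converse of `isAdmissible_dual_of_isDualAdmissible`.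
[cite: MulmuleySohoniGCT2SIAM2008, Def. 4.1 (arXiv cs/0612134 Def. 5.1)] -/
theorem isDualAdmissible_of_isAdmissible_dual {ρ : Representation k G V} {H : Subgroup G}
    (h : IsAdmissible ρ.dual H) : IsDualAdmissible H ρ := by
  obtain ⟨φ, hφ0, hφ⟩ := isAdmissible_iff_exists.mp h
  refine ⟨φ, hφ0, fun g hg => ?_⟩
  have h1 := hφ g⁻¹ (H.inv_mem hg)
  rw [Representation.dual_apply, inv_inv, Module.Dual.transpose_apply] at h1
  exact h1

/-- `W^*` is `H`-admissible iff `W` is dually `H`-admissible (the two bookkeepings of the tree,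
`IsAdmissible ρ.dual H` of BLMW 2011 Def. 6.1.3 and `IsDualAdmissible H ρ` of MS 2008 Def. 4.1,
agree). [cite: MulmuleySohoniGCT2SIAM2008, Def. 4.1 (arXiv cs/0612134 Def. 5.1)] -/
theorem isAdmissible_dual_iff_isDualAdmissible {ρ : Representation k G V} {H : Subgroup G} :
    IsAdmissible ρ.dual H ↔ IsDualAdmissible H ρ :=
  ⟨isDualAdmissible_of_isAdmissible_dual, isAdmissible_dual_of_isDualAdmissible⟩

end Bookkeeping

/-! ### §2 The heart: matrix coefficients of an invariant functional lie in the bound space -/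

section Heart

variable {σ : Type*} [Fintype σ] [LinearOrder σ] {k : Type*} [Field k]

/-- **Matrix coefficients of `k[Δ_m(f)]` are polynomial**: for `x ∈ k[Δ_m(f)]` and a linear
functional `θ`, `g ↦ θ(g⁻¹ · x)` is a polynomial `Q` in the entries of `g` (the tree's
`exists_apply_coordSubst_eq_eval_inv`, composed with the quotient map). Bläser–Ikenmeyer Ex. 11.2;
BLMW 2011 §5.1. [cite: BLMW2011, §5.1] -/
theorem exists_eval_eq_apply_orbitCoordRep_inv (f : MvPolynomial σ k) (m : ℕ)
    (x : OrbitCoordRing f m) (θ : Module.Dual k (OrbitCoordRing f m)) :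
    ∃ Q : MvPolynomial (σ × σ) k, ∀ g : GL σ k,
      eval (fun ij : σ × σ => (g : Matrix σ σ k) ij.1 ij.2) Q = θ (orbitCoordRep f m g⁻¹ x) := by
  obtain ⟨F, rfl⟩ := Ideal.Quotient.mk_surjective x
  obtain ⟨Q, hQ⟩ := exists_apply_coordSubst_eq_eval_inv m F
    (θ ∘ₗ (Ideal.Quotient.mkₐ k (orbitVanishingIdeal f m)).toLinearMap)
  refine ⟨Q, fun g => ?_⟩
  have h := hQ g⁻¹
  rw [inv_inv] at h
  rw [← h, orbitCoordRep_apply, orbitCoordSubst_mk]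
  rfl

/-- **Left semi-invariance** of the matrix coefficient `P(g) = θ(g⁻¹ · x)` of a highest-weight
vector `x` of weight `χ`: `P(b g) = χ(b)⁻¹ P(g)` for upper triangular `b`. BLMW 2011 §5.2 (left
translations on `ℂ[GL·x]`). [cite: BLMW2011, §5.2] -/
theorem eval_mul_left_of_mem_highestWeightSpace {f : MvPolynomial σ k} {m : ℕ} {χ : Weight σ}
    {x : OrbitCoordRing f m} (hx : x ∈ highestWeightSpace (orbitCoordRep f m) χ)
    (θ : Module.Dual k (OrbitCoordRing f m)) {Q : MvPolynomial (σ × σ) k}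
    (hQ : ∀ g : GL σ k,
      eval (fun ij : σ × σ => (g : Matrix σ σ k) ij.1 ij.2) Q = θ (orbitCoordRep f m g⁻¹ x))
    {b : GL σ k} (hb : IsUpperTriangular b) (g : GL σ k) :
    eval (fun ij : σ × σ => ((b : Matrix σ σ k) * (g : Matrix σ σ k)) ij.1 ij.2) Q =
      (weightChar χ b)⁻¹ * eval (fun ij : σ × σ => (g : Matrix σ σ k) ij.1 ij.2) Q := by
  have hb' : IsUpperTriangular b⁻¹ := (borelSubgroup σ k).inv_mem hb
  rw [← Units.val_mul, hQ, hQ, mul_inv_rev, map_mul, Module.End.mul_apply, hx b⁻¹ hb',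
    map_smul, map_smul, smul_eq_mul, weightChar_inv χ hb]

/-- **Right invariance** of the matrix coefficient `P(g) = θ(g⁻¹ · x)` under a subgroup `K` fixing
`θ` on the orbit of `x`: `P(g h) = P(g)` for `h ∈ K`. BLMW 2011 §5.2 (right translations).
[cite: BLMW2011, §5.2] -/
theorem eval_mul_right_of_invariant {f : MvPolynomial σ k} {m : ℕ} {x : OrbitCoordRing f m}
    (θ : Module.Dual k (OrbitCoordRing f m)) {Q : MvPolynomial (σ × σ) k}
    (hQ : ∀ g : GL σ k,
      eval (fun ij : σ × σ => (g : Matrix σ σ k) ij.1 ij.2) Q = θ (orbitCoordRep f m g⁻¹ x))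
    (K : Subgroup (GL σ k))
    (hθK : ∀ κ ∈ K, ∀ g : GL σ k,
      θ (orbitCoordRep f m κ (orbitCoordRep f m g x)) = θ (orbitCoordRep f m g x))
    {h : GL σ k} (hh : h ∈ K) (g : GL σ k) :
    eval (fun ij : σ × σ => ((g : Matrix σ σ k) * (h : Matrix σ σ k)) ij.1 ij.2) Q =
      eval (fun ij : σ × σ => (g : Matrix σ σ k) ij.1 ij.2) Q := by
  rw [← Units.val_mul, hQ, hQ, mul_inv_rev, map_mul, Module.End.mul_apply]
  exact hθK h⁻¹ (K.inv_mem hh) g⁻¹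

/-- **Scalars pin the degree**: the matrix coefficient `P(g) = θ(g⁻¹ · x)` of a highest-weight
vector of weight `χ`, `∑ χ = -D`, is homogeneous of degree `D` (`P(t g) = t^D P(g)`,
`isHomogeneous_of_eval_smul_eq`). BLMW 2011 §5.1 («this inclusion respects degree»).
[cite: BLMW2011, §5.1] -/
theorem isHomogeneous_of_mem_highestWeightSpace_of_eval_eq [CharZero k] {f : MvPolynomial σ k}
    {m : ℕ} {χ : Weight σ} {x : OrbitCoordRing f m}
    (hx : x ∈ highestWeightSpace (orbitCoordRep f m) χ)
    (θ : Module.Dual k (OrbitCoordRing f m)) {Q : MvPolynomial (σ × σ) k}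
    (hQ : ∀ g : GL σ k,
      eval (fun ij : σ × σ => (g : Matrix σ σ k) ij.1 ij.2) Q = θ (orbitCoordRep f m g⁻¹ x))
    {D : ℕ} (hsize : χ.size = -(D : ℤ)) : Q.IsHomogeneous D := by
  classical
  apply isHomogeneous_of_eval_smul_eq
  intro g t ht
  set s : GL σ k := torusElt (fun _ : σ => t) (fun _ => ht) with hs
  have hsU : IsUpperTriangular s := (isDiagonalGL_torusElt _ _).isUpperTriangular
  have h := eval_mul_left_of_mem_highestWeightSpace hx θ hQ hsU g
  have hcoe : ((s : GL σ k) : Matrix σ σ k) * (g : Matrix σ σ k) = t • (g : Matrix σ σ k) := by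
    rw [hs, coe_torusElt, ← Matrix.smul_one_eq_diagonal, smul_mul_assoc, one_mul]
  have hwc : weightChar χ s = t ^ (-(D : ℤ)) := by
    rw [hs, weightChar_torusElt, prod_zpow_eq_zpow_sum ht, ← hsize]
    rfl
  rw [hcoe, hwc, zpow_neg, inv_inv, zpow_natCast] at h
  exact h

/-- **The heart lemma.** Characteristic zero; `f` any polynomial on `k^σ`, `e : Fin N ≃o σ`,
`∑ χ = -D`, `X ≤ (k^N)^{⊗D}` containing every vector fixed by a family `S ⊆ GL_N(k)`, `K ≤ GL_σ(k)`
a subgroup containing `S` (reindexed). If `x ∈ k[Δ_m(f)]` is a highest-weight vector of weight `χ`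
and `θ` a linear functional on `k[Δ_m(f)]` which is `K`-invariant on the orbit `GL·x` and not
identically zero there, then the bound space `boundSpace (χ ∘ e) X` of BLMW's count is non-zero:
the matrix coefficient `g ↦ θ(g⁻¹·x)`, transported to `Mat_N`, is `pairPoly L` for an `L` in it
(`exists_mem_boundSpace`, Fulton–Harris Lemma 6.23), and `L ≠ 0`. BLMW 2011 §5.2, proof of
Prop. 5.2.1 («`ℂ[GL·x] = ℂ[GL]^{H}`», here with the invariance supplied by the functional).
[cite: BLMW2011, §5.2 Prop. 5.2.1 (proof)] -/
theorem boundSpace_ne_bot_of_invariant_functional [CharZero k] (f : MvPolynomial σ k) (m : ℕ)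
    (χ : Weight σ) {N D : ℕ} (e : Fin N ≃o σ) (hsize : χ.size = -(D : ℤ))
    (X : Submodule k (Word N D → k)) (S : GL (Fin N) k → Prop)
    (hSX : ∀ y : Word N D → k, (∀ h, S h → wordRep k N D h y = y) → y ∈ X)
    (K : Subgroup (GL σ k)) (hSK : ∀ h, S h → reindexGL e h ∈ K)
    {x : OrbitCoordRing f m} (hx : x ∈ highestWeightSpace (orbitCoordRep f m) χ)
    (θ : Module.Dual k (OrbitCoordRing f m))
    (hθK : ∀ κ ∈ K, ∀ g : GL σ k,
      θ (orbitCoordRep f m κ (orbitCoordRep f m g x)) = θ (orbitCoordRep f m g x))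
    (hne : ∃ g : GL σ k, θ (orbitCoordRep f m g x) ≠ 0) :
    boundSpace k (χ ∘ e) X ≠ ⊥ := by
  classical
  obtain ⟨Q, hQ⟩ := exists_eval_eq_apply_orbitCoordRep_inv f m x θ
  -- the transported matrix coefficient lies in `pairPoly (boundSpace)`
  obtain ⟨L, hL, hLP⟩ := exists_mem_boundSpace k (χ := χ ∘ e) (X := X) (transportPoly e Q)
    (isHomogeneous_transportPoly e
      (isHomogeneous_of_mem_highestWeightSpace_of_eval_eq hx θ hQ hsize))
    (eval_transportPoly_mul_left e Q χ fun b hb g =>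
      eval_mul_left_of_mem_highestWeightSpace hx θ hQ hb g)
    S hSX
    (fun h hh => eval_transportPoly_mul_right e Q h fun g =>
      eval_mul_right_of_invariant θ hQ K hθK (hSK h hh) g)
  intro hbot
  rw [hbot, Submodule.mem_bot] at hL
  rw [hL, map_zero] at hLP
  -- so `Q = 0`, and `θ` vanishes on the orbit of `x`
  have hQ0 : Q = 0 := transportPoly_injective e (by rw [← hLP, map_zero])
  obtain ⟨g, hg⟩ := hne
  apply hg
  have h1 := hQ g⁻¹
  rw [inv_inv, hQ0, map_zero] at h1
  exact h1.symm

/-- Numerical form of the heart lemma: under its hypotheses `0 < dim boundSpace (χ ∘ e) X`.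
[cite: BLMW2011, §5.2 Prop. 5.2.1 (proof)] -/
theorem finrank_boundSpace_pos_of_invariant_functional [CharZero k] (f : MvPolynomial σ k) (m : ℕ)
    (χ : Weight σ) {N D : ℕ} (e : Fin N ≃o σ) (hsize : χ.size = -(D : ℤ))
    (X : Submodule k (Word N D → k)) (S : GL (Fin N) k → Prop)
    (hSX : ∀ y : Word N D → k, (∀ h, S h → wordRep k N D h y = y) → y ∈ X)
    (K : Subgroup (GL σ k)) (hSK : ∀ h, S h → reindexGL e h ∈ K)
    {x : OrbitCoordRing f m} (hx : x ∈ highestWeightSpace (orbitCoordRep f m) χ)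
    (θ : Module.Dual k (OrbitCoordRing f m))
    (hθK : ∀ κ ∈ K, ∀ g : GL σ k,
      θ (orbitCoordRep f m κ (orbitCoordRep f m g x)) = θ (orbitCoordRep f m g x))
    (hne : ∃ g : GL σ k, θ (orbitCoordRep f m g x) ≠ 0) :
    0 < Module.finrank k (boundSpace k (χ ∘ e) X) :=
  Nat.pos_of_ne_zero fun h0 =>
    boundSpace_ne_bot_of_invariant_functional f m χ e hsize X S hSX K hSK hx θ hθK hne
      (Submodule.finrank_eq_zero.mp h0)

end Heart

/-! ### §3 The determinant: Borel pairs and the Kronecker count -/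

section Determinant

variable (k : Type*) [Field k] (m : ℕ)

/-- **`dim T = g(λ, m × d, m × d)`**: for `λ ⊢ m·d` with at most `m²` parts the bound space of
BLMW's count, `boundSpace λ* (kronInvariants k m (m d))` (columns in the transposed weight space
of `λ*`, rows invariant under the Borel pairs `a ⊗ b`), has dimension the rectangular Kronecker
coefficient. This is the count inside `orbitMultiplicity_det_le_kroneckerCoeff_holds`
(`D!·dim T = ∑_τ χ^λ(τ) χ^□(τ)² = D!·g(λ, □, □)`), stated on its own. BLMW 2011 §5.2 Prop. 5.2.1
(proof: «To have a trivial `SL(E) × SL(F)` action on `S_μE ⊗ S_νF`, we need `μ = ν = (δ^n)`»).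
[cite: BLMW2011, §5.2 Prop. 5.2.1 (proof)] -/
theorem finrank_boundSpace_kronInvariants_eq_kroneckerCoeff [CharZero k] {d : ℕ}
    (lam : Nat.Partition (m * d)) (hlam : lam.parts.card ≤ m * m) :
    Module.finrank k
        (boundSpace k (Weight.dualOfPartition (m * m) lam) (kronInvariants k m (m * d))) =
      kroneckerCoeff k lam (Nat.Partition.rectangle m d) (Nat.Partition.rectangle m d) := by
  set χ₀ : Weight (Fin (m * m)) := Weight.dualOfPartition (m * m) lam with hχ₀
  set X : Submodule k (Word (m * m) (m * d) → k) := kronInvariants k m (m * d) with hXdef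
  have hX : ∀ τ : Equiv.Perm (Fin (m * d)), X ≤ X.comap (wordPermRep k (m * m) (m * d) τ) :=
    fun τ _ hx => wordPerm_mem_kronInvariants k m τ hx
  -- `D! · dim T = ∑ χ^λ (χ^□)²`
  have hcount := card_mul_finrank_boundSpace k χ₀ X hX
  rw [Fintype.card_perm, Fintype.card_fin, hχ₀,
    character_transposedPermRep_dualOfPartition k lam hlam] at hcount
  have hchar : ((wordPermRep k (m * m) (m * d)).subrepresentation X hX).character =
      spechtCharacter k (Nat.Partition.rectangle m d) *
        spechtCharacter k (Nat.Partition.rectangle m d) :=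
    character_kronInvariantsPermRep k d
  rw [hchar] at hcount
  -- `∑ χ^λ χ^□ χ^□ = D! · g(λ, □, □)`
  have hkron := kroneckerCoeff_eq_sum_spechtCharacter_holds k lam (Nat.Partition.rectangle m d)
    (Nat.Partition.rectangle m d)
  have heq : ((Module.finrank k (boundSpace k χ₀ X) : ℕ) : k) =
      (kroneckerCoeff k lam (Nat.Partition.rectangle m d) (Nat.Partition.rectangle m d) : k) := by
    have hfact : (((m * d).factorial : ℕ) : k) ≠ 0 :=
      Nat.cast_ne_zero.mpr (Nat.factorial_ne_zero _)
    apply mul_left_cancel₀ hfact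
    rw [hcount, ← Nat.cast_mul, hkron]
    refine Finset.sum_congr rfl fun τ _ => ?_
    rw [Pi.mul_apply]
    ring
  exact Nat.cast_injective (R := k) heq

/-- **The Borel pairs lie in `SL_{m²} ∩ Stab(det_m)`**: for `a, b ∈ GL_m(k)` with
`det a = det b = 1`, the reindexed Kronecker product `a ⊗ b ∈ GL(k^{m×m})` has determinant
`(det a)^m (det b)^m = 1` (Mathlib `Matrix.det_kronecker`) and fixes `det_m`
(`linSubstRep_reindexGL_kronFin_detFormLex`). BLMW 2011 §5.2 (`S(GL(E) × GL(F)) ⊂ GL(W)(det_n)`).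
[cite: BLMW2011, §5.2] -/
theorem reindexGL_kronFin_mem_slSubgroup_inf_linStabilizer_detFormLex {a b : GL (Fin m) k}
    (ha : (a : Matrix (Fin m) (Fin m) k).det = 1) (hb : (b : Matrix (Fin m) (Fin m) k).det = 1) :
    reindexGL (k := k) (matIdxEquiv m) (kronFin k m a b) ∈
      slSubgroup (MatIdx m) k ⊓ linStabilizer (detFormLex k m) := by
  refine Subgroup.mem_inf.mpr ⟨mem_slSubgroup_iff.mpr ?_,
    mem_linStabilizer.mpr (linSubstRep_reindexGL_kronFin_detFormLex k m ha hb)⟩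
  rw [coe_reindexGL_kronFin, Matrix.det_reindex_self, Matrix.det_kronecker, ha, hb, one_pow,
    mul_one]

/-- **A non-zero `SL_{m²} ∩ Stab(det_m)`-invariant functional on the span of a highest-weight
vector of weight `λ*` forces `g(λ, m × d, m × d) > 0`** (characteristic zero; `λ ⊢ m·d` with at
most `m²` parts; `f` ANY polynomial on `k^{m×m}`, `x ∈ k[Δ_m(f)]` a highest-weight vector of weight
`λ*`, `θ` a functional on `k[Δ_m(f)]` invariant under `SL ∩ Stab(det_m)` on `GL·x` and not
identically zero there). The heart lemma with BLMW's data: `X = kronInvariants`, `S` = the Borel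
pairs, `K = SL ∩ Stab(det_m)`, and the count `dim T = g(λ, □, □)`.
[cite: BLMW2011, §5.2 Prop. 5.2.1 (proof)] -/
theorem kroneckerCoeff_pos_of_detStabilizerInvariant_functional [CharZero k] {d : ℕ}
    (lam : Nat.Partition (m * d)) (hlam : lam.parts.card ≤ m * m)
    (f : MvPolynomial (MatIdx m) k) {x : OrbitCoordRing f m}
    (hx : x ∈ highestWeightSpace (orbitCoordRep f m)
      ((Weight.dualOfPartition (m * m) lam).toMatIdx : Weight (MatIdx m)))
    (θ : Module.Dual k (OrbitCoordRing f m))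
    (hθ : ∀ κ ∈ slSubgroup (MatIdx m) k ⊓ linStabilizer (detFormLex k m), ∀ g : GL (MatIdx m) k,
      θ (orbitCoordRep f m κ (orbitCoordRep f m g x)) = θ (orbitCoordRep f m g x))
    (hne : ∃ g : GL (MatIdx m) k, θ (orbitCoordRep f m g x) ≠ 0) :
    0 < kroneckerCoeff k lam (Nat.Partition.rectangle m d) (Nat.Partition.rectangle m d) := by
  have hpos := finrank_boundSpace_pos_of_invariant_functional f m
    ((Weight.dualOfPartition (m * m) lam).toMatIdx : Weight (MatIdx m)) (matIdxEquiv m)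
    (size_toMatIdx_dualOfPartition m lam hlam) (kronInvariants k m (m * d))
    (IsKronUnimodularBorel k m) (mem_kronInvariants_of_forall k m)
    (slSubgroup (MatIdx m) k ⊓ linStabilizer (detFormLex k m))
    (fun h hh => by
      obtain ⟨a, b, _, ha1, _, hb1, rfl⟩ := hh
      exact reindexGL_kronFin_mem_slSubgroup_inf_linStabilizer_detFormLex k m ha1 hb1)
    hx θ hθ hne
  rwa [toMatIdx_comp_matIdxEquiv, finrank_boundSpace_kronInvariants_eq_kroneckerCoeff k m lam hlam]
    at hpos

end Determinant

/-! ### §4 Packaging: the span of a highest-weight vector and its dual -/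

section Span

variable (k : Type*) [Field k] (m : ℕ)

/-- **`W^*` has no `SL ∩ Stab(det_m)`-invariant unless `g(λ, m × d, m × d) > 0`.** Here `W` is
the `GL_{m²}`-span of a highest-weight vector `x` of weight `λ*` in `k[Δ_m(f)]` (`f` any polynomial
on `k^{m×m}`, characteristic zero, `λ ⊢ m·d` with at most `m²` parts): a non-zero functional on `W`
invariant under `SL_{m²} ∩ Stab(det_m)` (`IsDualAdmissible`) gives `0 < g(λ, □, □)` — extend it to
`k[Δ_m(f)]` (`LinearMap.exists_extend`) and apply
`kroneckerCoeff_pos_of_detStabilizerInvariant_functional`. BLMW 2011 §5.2 Prop. 5.2.1 (proof).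
[cite: BLMW2011, §5.2 Prop. 5.2.1 (proof)] -/
theorem kroneckerCoeff_pos_of_isDualAdmissible_detStabilizer [CharZero k] {d : ℕ}
    (lam : Nat.Partition (m * d)) (hlam : lam.parts.card ≤ m * m)
    (f : MvPolynomial (MatIdx m) k) {x : OrbitCoordRing f m}
    (hx : x ∈ highestWeightSpace (orbitCoordRep f m)
      ((Weight.dualOfPartition (m * m) lam).toMatIdx : Weight (MatIdx m)))
    (W : Subrepresentation (orbitCoordRep f m))
    (hW : W.toSubmodule =
      Submodule.span k (Set.range fun g : GL (MatIdx m) k => orbitCoordRep f m g x))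
    (hadm : IsDualAdmissible (slSubgroup (MatIdx m) k ⊓ linStabilizer (detFormLex k m))
      W.toRepresentation) :
    0 < kroneckerCoeff k lam (Nat.Partition.rectangle m d) (Nat.Partition.rectangle m d) := by
  obtain ⟨φ, hφ0, hφ⟩ := hadm
  obtain ⟨θ, hθ⟩ := LinearMap.exists_extend φ
  have hmem : ∀ g : GL (MatIdx m) k, orbitCoordRep f m g x ∈ W.toSubmodule := fun g => by
    rw [hW]
    exact Submodule.subset_span ⟨g, rfl⟩
  have hθW : ∀ w : W.toSubmodule, θ (w : OrbitCoordRing f m) = φ w := fun w => by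
    rw [← hθ]
    rfl
  refine kroneckerCoeff_pos_of_detStabilizerInvariant_functional k m lam hlam f hx θ
    (fun κ hκ g => ?_) ?_
  · -- invariance on the orbit: `θ(κ g x) = φ(κ · w) = φ(w) = θ(g x)` with `w = g x ∈ W`
    set w : W.toSubmodule := ⟨_, hmem g⟩ with hw
    have h1 := LinearMap.congr_fun (hφ κ hκ) w
    rw [LinearMap.comp_apply] at h1
    calc θ (orbitCoordRep f m κ (orbitCoordRep f m g x))
        = θ ((W.toRepresentation κ w : W.toSubmodule) : OrbitCoordRing f m) := rfl
      _ = φ (W.toRepresentation κ w) := hθW _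
      _ = φ w := h1
      _ = θ (orbitCoordRep f m g x) := (hθW w).symm
  · -- non-vanishing on the orbit: otherwise `θ`, hence `φ`, kills `W = span (GL·x)`
    by_contra hall
    apply hφ0
    ext w
    have hker : W.toSubmodule ≤ LinearMap.ker θ := by
      rw [hW, Submodule.span_le]
      rintro _ ⟨g, rfl⟩
      exact LinearMap.mem_ker.mpr (not_not.mp fun hg => hall ⟨g, hg⟩)
    rw [LinearMap.zero_apply, ← hθW]
    exact LinearMap.mem_ker.mp (hker w.2)

/-- **Kronecker vanishing kills the `SL ∩ Stab(det_m)`-invariants of `W^*`** (contrapositive of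
`kroneckerCoeff_pos_of_isDualAdmissible_detStabilizer`): `g(λ, m × d, m × d) = 0` ⇒ the span `W`
of a highest-weight vector of weight `λ*` in `k[Δ_m(f)]` is not dually admissible for
`SL_{m²} ∩ Stab(det_m)`. [cite: BLMW2011, §5.2 Prop. 5.2.1 (proof)] -/
theorem not_isDualAdmissible_detStabilizer_of_kroneckerCoeff_eq_zero [CharZero k] {d : ℕ}
    (lam : Nat.Partition (m * d)) (hlam : lam.parts.card ≤ m * m)
    (f : MvPolynomial (MatIdx m) k) {x : OrbitCoordRing f m}
    (hx : x ∈ highestWeightSpace (orbitCoordRep f m)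
      ((Weight.dualOfPartition (m * m) lam).toMatIdx : Weight (MatIdx m)))
    (W : Subrepresentation (orbitCoordRep f m))
    (hW : W.toSubmodule =
      Submodule.span k (Set.range fun g : GL (MatIdx m) k => orbitCoordRep f m g x))
    (hk : kroneckerCoeff k lam (Nat.Partition.rectangle m d) (Nat.Partition.rectangle m d) = 0) :
    ¬ IsDualAdmissible (slSubgroup (MatIdx m) k ⊓ linStabilizer (detFormLex k m))
      W.toRepresentation :=
  fun hadm =>
    (kroneckerCoeff_pos_of_isDualAdmissible_detStabilizer k m lam hlam f hx W hW hadm).ne' hk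

/-- The same in the currency of GCT I Thm. 5.1 («`W` contains no trivial `Q`-submodule», for the
module `W^*`): `g(λ, m × d, m × d) = 0` ⇒ `W^*` is not `SL_{m²} ∩ Stab(det_m)`-admissible.
[cite: MulmuleySohoniSIAM2001, Thm. 5.1 (AV p.20)] -/
theorem not_isAdmissible_dual_detStabilizer_of_kroneckerCoeff_eq_zero [CharZero k] {d : ℕ}
    (lam : Nat.Partition (m * d)) (hlam : lam.parts.card ≤ m * m)
    (f : MvPolynomial (MatIdx m) k) {x : OrbitCoordRing f m}
    (hx : x ∈ highestWeightSpace (orbitCoordRep f m)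
      ((Weight.dualOfPartition (m * m) lam).toMatIdx : Weight (MatIdx m)))
    (W : Subrepresentation (orbitCoordRep f m))
    (hW : W.toSubmodule =
      Submodule.span k (Set.range fun g : GL (MatIdx m) k => orbitCoordRep f m g x))
    (hk : kroneckerCoeff k lam (Nat.Partition.rectangle m d) (Nat.Partition.rectangle m d) = 0) :
    ¬ IsAdmissible W.toRepresentation.dual
      (slSubgroup (MatIdx m) k ⊓ linStabilizer (detFormLex k m)) :=
  fun h => not_isDualAdmissible_detStabilizer_of_kroneckerCoeff_eq_zero k m lam hlam f hx W hW hk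
    (isDualAdmissible_of_isAdmissible_dual h)

end Span

/-! ### §5 The first-criterion module of a Kronecker-vanishing occurrence -/

section FirstCriterionModule

variable (k : Type) [Field k] [IsAlgClosed k] [CharZero k]

/-- **Kronecker-vanishing occurrence obstructions are first-criterion modules** (over an
algebraically closed field of characteristic zero). Let `h` be a form of degree `m ≠ 0` on
`k^{m×m}`, `λ ⊢ m·d` with at most `m²` parts, `0 < mult_{λ*} k[Δ_m(h)]` and
`g(λ, m × d, m × d) = 0`. Then the `GL_{m²}`-span `W ≤ k[Δ_m(h)]_d` of a highest-weight vector of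
weight `λ*` is irreducible, its dual `W^*` contains a non-zero `SL ∩ Stab(h)`-invariant
(evaluation at `ĥ`: Mulmuley–Sohoni 2008 Prop. 4.2, tree theorem
`isDualAdmissible_stabilizer_of_subrepresentation`, `SL·[h] = GL·[h]`), and `W^*` contains NO
non-zero `SL ∩ Stab(det_m)`-invariant (§4). This is the module asked for after GCT I Ex. 5.2.1
(«a representation `W` … such that `W` contains a trivial `H`-representation but not a trivial
`Q`-representation»), for the pair `(h, det_m)`, whenever such a `λ` exists.
[cite: MulmuleySohoniSIAM2001, Thm. 5.1 and §5.2 after Ex. 5.2.1 (AV pp.20–22)] -/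
theorem exists_firstCriterionModule_of_kroneckerCoeff_eq_zero {m d : ℕ} (hm : m ≠ 0)
    {h : MvPolynomial (MatIdx m) k} (hh : h.IsHomogeneous m)
    (lam : Nat.Partition (m * d)) (hlam : lam.parts.card ≤ m * m)
    (hmult : 0 < orbitMultiplicity k h m
      ((Weight.dualOfPartition (m * m) lam).toMatIdx : Weight (MatIdx m)))
    (hk : kroneckerCoeff k lam (Nat.Partition.rectangle m d) (Nat.Partition.rectangle m d) = 0) :
    ∃ W : Subrepresentation (orbitCoordRep h m),
      W.toSubmodule ≤ orbitCoordRingDeg h m d ∧ W.toRepresentation.IsIrreducible ∧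
      IsAdmissible W.toRepresentation.dual (slSubgroup (MatIdx m) k ⊓ linStabilizer h) ∧
      ¬ IsAdmissible W.toRepresentation.dual
        (slSubgroup (MatIdx m) k ⊓ linStabilizer (detFormLex k m)) := by
  set χ : Weight (MatIdx m) := (Weight.dualOfPartition (m * m) lam).toMatIdx with hχdef
  have hχ : χ.size = -((m * d : ℕ) : ℤ) := size_toMatIdx_dualOfPartition m lam hlam
  -- a non-zero highest-weight vector of weight `λ*`, in degree `d`
  obtain ⟨v, hv0, hv⟩ := (hasHighestWeight_iff_exists _ _).mp
    ((orbitMultiplicity_pos_iff_hasHighestWeight h hm χ).mp hmult)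
  have hvd : v ∈ orbitCoordRingDeg h m d :=
    mem_orbitCoordRingDeg_of_mem_highestWeightSpace h hm hχ hv
  haveI : FiniteDimensional k (orbitCoordSubrep h m d).toSubmodule :=
    finiteDimensional_orbitCoordRingDeg h m d
  -- `W` := the span of its orbit: inside degree `d`, irreducible, non-zero
  obtain ⟨W, hW⟩ : ∃ W : Subrepresentation (orbitCoordRep h m),
      W.toSubmodule = Submodule.span k (Set.range fun γ : GL (MatIdx m) k => orbitCoordRep h m γ v) :=
    ⟨⟨_, fun γ _ hy => apply_mem_span_orbit _ v γ hy⟩, rfl⟩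
  have hWle : W.toSubmodule ≤ orbitCoordRingDeg h m d := by
    rw [hW, Submodule.span_le]
    rintro _ ⟨γ, rfl⟩
    exact orbitCoordRep_mem_orbitCoordRingDeg h m d γ hvd
  have hWirr : W.toRepresentation.IsIrreducible :=
    isIrreducible_toRepresentation_of_eq_span_orbit (orbitCoordSubrep h m d)
      (isRationalRep_orbitCoordRepDeg h m d) hvd hv hv0 W hW
  have hvW : v ∈ W.toSubmodule := by
    rw [hW]
    exact Submodule.subset_span ⟨1, show orbitCoordRep h m 1 v = v by
      rw [map_one, Module.End.one_apply]⟩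
  have hW0 : W.toSubmodule ≠ ⊥ := fun hbot => hv0 (by
    rw [hbot] at hvW
    exact (Submodule.mem_bot k).mp hvW)
  refine ⟨W, hWle, hWirr, ?_, ?_⟩
  · exact isAdmissible_dual_of_isDualAdmissible
      (isDualAdmissible_stabilizer_of_subrepresentation (hasFullProjectiveOrbit_slSubgroup hh)
        W hWle hW0)
  · exact not_isAdmissible_dual_detStabilizer_of_kroneckerCoeff_eq_zero k m lam hlam h hv W hW hk

end FirstCriterionModule

/-! ### §6 Over `ℂ`: the first criterion, and the instance `(per₃, det₃)` modulo one class sum -/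

section Complex

open TableauEval

/-- **GCT I Thm. 5.1 (first criterion) applied to a Kronecker-vanishing occurrence**, over `ℂ`:
`h` a POLYSTABLE form of degree `m ≠ 0` on `ℂ^{m×m}`, `λ ⊢ m·d` with at most `m²` parts,
`0 < mult_{λ*} ℂ[Δ_m(h)]`, `g(λ, m × d, m × d) = 0` ⇒ `h ∉ Δ(det_m)`. The module `W^*` of §5 has a
trivial `SL ∩ Stab(h)`-submodule and no trivial `SL ∩ Stab(det_m)`-submodule; by Thm. 5.1 (first
criterion over `ℂ`, tree theorem `isAdmissible_stabilizer_of_mem_orbitClosure_of_orbitQuotient`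
with `Grosshans1997_thm_1_11_slOrbit_forms_holds`; `W^*` is rational, `isRationalRep_dual`)
`h ∈ Δ(det_m)` is impossible.
[cite: MulmuleySohoniSIAM2001, Thm. 5.1 (AV p.20, journal Thm. 5.1)] -/
theorem not_mem_orbitClosure_detFormLex_of_kroneckerCoeff_eq_zero {m d : ℕ} (hm : m ≠ 0)
    {h : MvPolynomial (MatIdx m) ℂ} (hh : h.IsHomogeneous m) (hst : IsPolystable h)
    (lam : Nat.Partition (m * d)) (hlam : lam.parts.card ≤ m * m)
    (hmult : 0 < orbitMultiplicity ℂ h m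
      ((Weight.dualOfPartition (m * m) lam).toMatIdx : Weight (MatIdx m)))
    (hk : kroneckerCoeff ℂ lam (Nat.Partition.rectangle m d) (Nat.Partition.rectangle m d) = 0) :
    h ∉ orbitClosure (detFormLex ℂ m) := by
  intro hmem
  obtain ⟨W, hWle, -, hH, hQ⟩ :=
    exists_firstCriterionModule_of_kroneckerCoeff_eq_zero ℂ hm hh lam hlam hmult hk
  haveI : FiniteDimensional ℂ (orbitCoordRingDeg h m d) := finiteDimensional_orbitCoordRingDeg h m d
  haveI : FiniteDimensional ℂ W.toSubmodule := Submodule.finiteDimensional_of_le hWle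
  exact hQ (isAdmissible_stabilizer_of_mem_orbitClosure_of_orbitQuotient
    Grosshans1997_thm_1_11_slOrbit_forms_holds hh (detFormLex_isHomogeneous ℂ m) hst hmem
    W.toRepresentation.dual (isRationalRep_dual ((isRationalRep_orbitCoordRep h m).toRepresentation W))
    hH)

/-- `per_m`, as the form `paddedPerFormLex ℂ m m` on `ℂ^{m×m}` (no padding), is polystable:
Bürgisser–Ikenmeyer 2017 Cor. 2.9 (tree theorem `BurgisserIkenmeyer2017_polystable_det_per_holds`)
transported along `toLex` (`paddedPerFormLex_self`, `IsPolystable.rename_equiv`).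
[cite: BurgisserIkenmeyer2017, Cor. 2.9] -/
theorem isPolystable_paddedPerFormLex_self (m : ℕ) [NeZero m] :
    IsPolystable (paddedPerFormLex ℂ m m) := by
  rw [paddedPerFormLex_self]
  exact (BurgisserIkenmeyer2017_polystable_det_per_holds m).2.rename_equiv _

/-- **MS's invitation at `d = 3`, modulo one class sum.** `λ = (13,13,2,2,2,2,2) ⊢ 36` (the
partition of Bürgisser–Ikenmeyer 2013 §4.6, printed there as a type in the vanishing ideal
`I(Δ(det₃))₁₂`) occurs in `ℂ[Δ(per₃)]₁₂` by the tree's kernel certificate `cert1313_bound`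
(`1 ≤ mult_{λ*}`; not a statement of the paper). IF the rectangular Kronecker coefficient
`g(λ, (12,12,12), (12,12,12))`
vanishes (hypothesis `hk`; only `sk = 0` is kernel-certified in the tree), then the `GL₉`-span `W`
of a highest-weight vector of weight `λ*` in `ℂ[Δ(per₃)]₁₂` is irreducible, `W^*` has a non-zero
`SL₉ ∩ Stab(per₃)`-invariant and no non-zero `SL₉ ∩ Stab(det₃)`-invariant — a first-criterion
module for `(per₃, det₃)` in the sense of GCT I Thm. 5.1.
[cite: BurgisserIkenmeyer2013, §4.6 (arXiv:1210.8368 p.9, `(13,13,2,2,2,2,2) ⊢_7 36` in degree 12)] -/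
theorem per3Det3_firstCriterionModule_of_kroneckerCoeff_eq_zero
    (hk : kroneckerCoeff ℂ
        (cert1313.lamPartition (cert1313.lam_pos_of_verify cert1313_verify)
          (cert1313.lam_sum_of_verify cert1313_verify))
        (Nat.Partition.rectangle cert1313.m cert1313.d)
        (Nat.Partition.rectangle cert1313.m cert1313.d) = 0) :
    haveI : NeZero cert1313.m := ⟨by decide⟩
    ∃ W : Subrepresentation (orbitCoordRep (paddedPerFormLex ℂ cert1313.n cert1313.m) cert1313.m),
      W.toSubmodule ≤ orbitCoordRingDeg (paddedPerFormLex ℂ cert1313.n cert1313.m) cert1313.m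
          cert1313.d ∧
        W.toRepresentation.IsIrreducible ∧
        IsAdmissible W.toRepresentation.dual
          (slSubgroup (MatIdx cert1313.m) ℂ ⊓
            linStabilizer (paddedPerFormLex ℂ cert1313.n cert1313.m)) ∧
        ¬ IsAdmissible W.toRepresentation.dual
          (slSubgroup (MatIdx cert1313.m) ℂ ⊓ linStabilizer (detFormLex ℂ cert1313.m)) := by
  haveI : NeZero cert1313.m := ⟨by decide⟩
  have hmult : 0 < orbitMultiplicity ℂ (paddedPerFormLex ℂ cert1313.n cert1313.m) cert1313.m
      (cert1313.weight (cert1313.lam_pos_of_verify cert1313_verify)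
        (cert1313.lam_sum_of_verify cert1313_verify)) :=
    lt_of_lt_of_le (by decide) cert1313_bound
  exact exists_firstCriterionModule_of_kroneckerCoeff_eq_zero ℂ (by decide)
    (paddedPerFormLex_isHomogeneous ℂ (by decide)) _
    (by rw [TableauEval.Cert.card_lamPartition]; decide) hmult hk

/-- **`per₃ ∉ Δ(det₃)` by the first criterion of GCT I Thm. 5.1**, modulo the class sum `hk`
(`g((13,13,2,2,2,2,2), (12,12,12), (12,12,12)) = 0`): `per₃` is polystable
(`isPolystable_paddedPerFormLex_self`), `λ*` occurs in `ℂ[Δ(per₃)]` (`cert1313_bound`), and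
`not_mem_orbitClosure_detFormLex_of_kroneckerCoeff_eq_zero` applies. (The separation is classical;
the point is the route through a first-criterion module.)
[cite: MulmuleySohoniSIAM2001, Thm. 5.1 and Ex. 5.2.1 (AV pp.20–22)] -/
theorem paddedPerFormLex_three_not_mem_orbitClosure_detFormLex_of_kroneckerCoeff_eq_zero
    (hk : kroneckerCoeff ℂ
        (cert1313.lamPartition (cert1313.lam_pos_of_verify cert1313_verify)
          (cert1313.lam_sum_of_verify cert1313_verify))
        (Nat.Partition.rectangle cert1313.m cert1313.d)
        (Nat.Partition.rectangle cert1313.m cert1313.d) = 0) :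
    haveI : NeZero cert1313.m := ⟨by decide⟩
    paddedPerFormLex ℂ cert1313.n cert1313.m ∉ orbitClosure (detFormLex ℂ cert1313.m) := by
  haveI : NeZero cert1313.m := ⟨by decide⟩
  have hmult : 0 < orbitMultiplicity ℂ (paddedPerFormLex ℂ cert1313.n cert1313.m) cert1313.m
      (cert1313.weight (cert1313.lam_pos_of_verify cert1313_verify)
        (cert1313.lam_sum_of_verify cert1313_verify)) :=
    lt_of_lt_of_le (by decide) cert1313_bound
  exact not_mem_orbitClosure_detFormLex_of_kroneckerCoeff_eq_zero (by decide)
    (paddedPerFormLex_isHomogeneous ℂ (by decide)) (isPolystable_paddedPerFormLex_self cert1313.m) _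
    (by rw [TableauEval.Cert.card_lamPartition]; decide) hmult hk

end Complex

/-! ### §7 Counting: `dim (W^*)^K ≤ dim T` (the multiplicity form of the `Q`-side) -/

section Counting

variable {σ : Type*} [Fintype σ] [LinearOrder σ] {k : Type*} [Field k]

/-- **The heart lemma with its witnesses**: under the hypotheses of
`boundSpace_ne_bot_of_invariant_functional` except non-vanishing, the matrix coefficient
`g ↦ θ(g⁻¹ · x)` is a polynomial `Q` on `Mat_σ` whose transport to `Mat_N` is `pairPoly L` for some
`L` in the bound space `boundSpace (χ ∘ e) X`. BLMW 2011 §5.2, proof of Prop. 5.2.1.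
[cite: BLMW2011, §5.2 Prop. 5.2.1 (proof)] -/
theorem exists_mem_boundSpace_of_invariant_functional [CharZero k] (f : MvPolynomial σ k) (m : ℕ)
    (χ : Weight σ) {N D : ℕ} (e : Fin N ≃o σ) (hsize : χ.size = -(D : ℤ))
    (X : Submodule k (Word N D → k)) (S : GL (Fin N) k → Prop)
    (hSX : ∀ y : Word N D → k, (∀ h, S h → wordRep k N D h y = y) → y ∈ X)
    (K : Subgroup (GL σ k)) (hSK : ∀ h, S h → reindexGL e h ∈ K)
    {x : OrbitCoordRing f m} (hx : x ∈ highestWeightSpace (orbitCoordRep f m) χ)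
    (θ : Module.Dual k (OrbitCoordRing f m))
    (hθK : ∀ κ ∈ K, ∀ g : GL σ k,
      θ (orbitCoordRep f m κ (orbitCoordRep f m g x)) = θ (orbitCoordRep f m g x)) :
    ∃ Q : MvPolynomial (σ × σ) k,
      (∀ g : GL σ k,
        eval (fun ij : σ × σ => (g : Matrix σ σ k) ij.1 ij.2) Q = θ (orbitCoordRep f m g⁻¹ x)) ∧
      ∃ L ∈ boundSpace k (χ ∘ e) X, pairPoly k (Fin N) D L = transportPoly e Q := by
  classical
  obtain ⟨Q, hQ⟩ := exists_eval_eq_apply_orbitCoordRep_inv f m x θ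
  obtain ⟨L, hL, hLP⟩ := exists_mem_boundSpace k (χ := χ ∘ e) (X := X) (transportPoly e Q)
    (isHomogeneous_transportPoly e
      (isHomogeneous_of_mem_highestWeightSpace_of_eval_eq hx θ hQ hsize))
    (eval_transportPoly_mul_left e Q χ fun b hb g =>
      eval_mul_left_of_mem_highestWeightSpace hx θ hQ hb g)
    S hSX
    (fun h hh => eval_transportPoly_mul_right e Q h fun g =>
      eval_mul_right_of_invariant θ hQ K hθK (hSK h hh) g)
  exact ⟨Q, hQ, L, hL, hLP⟩

/-- **`dim (W^*)^K ≤ dim T`** (characteristic zero). Let `W` be the `GL_σ(k)`-span of a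
highest-weight vector `x` of weight `χ` (`∑ χ = -D`) in `k[Δ_m(f)]` (`f` any polynomial on `k^σ`),
`K ≤ GL_σ(k)` a subgroup containing (reindexed along `e : Fin N ≃o σ`) a family `S` whose common
fixed vectors in `(k^N)^{⊗D}` lie in `X`. Then the space of `K`-invariant vectors of the dual
representation `W^*` has dimension at most `dim boundSpace (χ ∘ e) X`: the map
`φ ↦ (g ↦ φ(g · x))` is a linear injection of `(W^*)^K` into the functions on `GL_σ(k)`
(`W = span (GL·x)`), and its image lies in the image of `pairPoly (boundSpace)` under evaluation
`P ↦ (g ↦ P(reindex g⁻¹))` (`exists_mem_boundSpace_of_invariant_functional`). This is the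
MULTIPLICITY form of BLMW's count «`mult_π ℂ[GL·x] = dim (S_π W)^{H}`» with `H` replaced by the
Borel-type family `S`, for an arbitrary span of a highest-weight vector.
[cite: BLMW2011, §5.2 Prop. 5.2.1 (proof)] -/
theorem finrank_subgroupInvariants_dual_le_finrank_boundSpace [CharZero k]
    (f : MvPolynomial σ k) (m : ℕ) (χ : Weight σ) {N D : ℕ} (e : Fin N ≃o σ)
    (hsize : χ.size = -(D : ℤ)) (X : Submodule k (Word N D → k)) (S : GL (Fin N) k → Prop)
    (hSX : ∀ y : Word N D → k, (∀ h, S h → wordRep k N D h y = y) → y ∈ X)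
    (K : Subgroup (GL σ k)) (hSK : ∀ h, S h → reindexGL e h ∈ K)
    {x : OrbitCoordRing f m} (hx : x ∈ highestWeightSpace (orbitCoordRep f m) χ)
    (W : Subrepresentation (orbitCoordRep f m))
    (hW : W.toSubmodule = Submodule.span k (Set.range fun g : GL σ k => orbitCoordRep f m g x)) :
    Module.finrank k (subgroupInvariants W.toRepresentation.dual K) ≤
      Module.finrank k (boundSpace k (χ ∘ e) X) := by
  classical
  have hmem : ∀ g : GL σ k, orbitCoordRep f m g x ∈ W.toSubmodule := fun g => by
    rw [hW]
    exact Submodule.subset_span ⟨g, rfl⟩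
  -- evaluation of polynomials on `Mat_N` along `g ↦ reindex g⁻¹`
  let Ev : MvPolynomial (Fin N × Fin N) k →ₗ[k] (GL σ k → k) :=
    { toFun := fun P g =>
        eval (fun ij : Fin N × Fin N => ((g⁻¹ : GL σ k) : Matrix σ σ k) (e ij.1) (e ij.2)) P
      map_add' := fun P P' => by
        funext g
        exact map_add _ _ _
      map_smul' := fun c P => by
        funext g
        change eval _ (c • P) = c * eval _ P
        exact smul_eval _ _ _ }
  -- the orbit coefficients of an invariant functional
  let R : ↥(subgroupInvariants W.toRepresentation.dual K) →ₗ[k] (GL σ k → k) :=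
    { toFun := fun φ g => (φ : Module.Dual k W.toSubmodule) ⟨orbitCoordRep f m g x, hmem g⟩
      map_add' := fun φ ψ => by
        funext g
        rfl
      map_smul' := fun c φ => by
        funext g
        rfl }
  -- an invariant functional on `W` extends to a functional on `k[Δ_m(f)]`, `K`-invariant on `GL·x`
  have hext : ∀ φ : ↥(subgroupInvariants W.toRepresentation.dual K),
      ∃ θ : Module.Dual k (OrbitCoordRing f m),
        (∀ w : W.toSubmodule, θ (w : OrbitCoordRing f m) = (φ : Module.Dual k W.toSubmodule) w) ∧
        ∀ κ ∈ K, ∀ g : GL σ k,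
          θ (orbitCoordRep f m κ (orbitCoordRep f m g x)) = θ (orbitCoordRep f m g x) := by
    intro φ
    obtain ⟨θ, hθ⟩ := LinearMap.exists_extend (φ : Module.Dual k W.toSubmodule)
    have hθW : ∀ w : W.toSubmodule, θ (w : OrbitCoordRing f m) =
        (φ : Module.Dual k W.toSubmodule) w := fun w => by
      rw [← hθ]
      rfl
    have hφ : ∀ κ ∈ K, (φ : Module.Dual k W.toSubmodule) ∘ₗ W.toRepresentation κ =
        (φ : Module.Dual k W.toSubmodule) := by
      intro κ hκ
      have h1 := mem_subgroupInvariants_iff.mp φ.2 κ⁻¹ (K.inv_mem hκ)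
      rw [Representation.dual_apply, inv_inv, Module.Dual.transpose_apply] at h1
      exact h1
    refine ⟨θ, hθW, fun κ hκ g => ?_⟩
    set w : W.toSubmodule := ⟨_, hmem g⟩ with hw
    have h1 := LinearMap.congr_fun (hφ κ hκ) w
    rw [LinearMap.comp_apply] at h1
    calc θ (orbitCoordRep f m κ (orbitCoordRep f m g x))
        = θ ((W.toRepresentation κ w : W.toSubmodule) : OrbitCoordRing f m) := rfl
      _ = (φ : Module.Dual k W.toSubmodule) (W.toRepresentation κ w) := hθW _
      _ = (φ : Module.Dual k W.toSubmodule) w := h1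
      _ = θ (orbitCoordRep f m g x) := (hθW w).symm
  -- `R` is injective: `W` is spanned by the orbit of `x`
  have hinj : Function.Injective R := by
    rw [injective_iff_map_eq_zero]
    intro φ h0
    obtain ⟨θ, hθW, -⟩ := hext φ
    have hker : W.toSubmodule ≤ LinearMap.ker θ := by
      rw [hW, Submodule.span_le]
      rintro _ ⟨g, rfl⟩
      have hg := congr_fun h0 g
      exact LinearMap.mem_ker.mpr ((hθW ⟨_, hmem g⟩).trans hg)
    apply Subtype.ext
    ext w
    rw [Submodule.coe_zero, LinearMap.zero_apply, ← hθW]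
    exact LinearMap.mem_ker.mp (hker w.2)
  -- its range lies in the evaluations of `pairPoly (boundSpace)`
  have hrange : LinearMap.range R ≤
      ((boundSpace k (χ ∘ e) X).map (pairPoly k (Fin N) D)).map Ev := by
    rintro _ ⟨φ, rfl⟩
    obtain ⟨θ, hθW, hθK⟩ := hext φ
    obtain ⟨Q, hQ, L, hL, hLP⟩ := exists_mem_boundSpace_of_invariant_functional f m χ e hsize X S
      hSX K hSK hx θ hθK
    refine ⟨pairPoly k (Fin N) D L, Submodule.mem_map_of_mem hL, ?_⟩
    funext g
    have h1 := hQ g⁻¹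
    rw [inv_inv] at h1
    change eval (fun ij : Fin N × Fin N => ((g⁻¹ : GL σ k) : Matrix σ σ k) (e ij.1) (e ij.2))
        (pairPoly k (Fin N) D L) =
      (φ : Module.Dual k W.toSubmodule) ⟨orbitCoordRep f m g x, hmem g⟩
    rw [hLP, ← hθW, ← h1,
      show (fun ij : Fin N × Fin N => ((g⁻¹ : GL σ k) : Matrix σ σ k) (e ij.1) (e ij.2)) =
          fun ij : Fin N × Fin N =>
            (((g⁻¹ : GL σ k) : Matrix σ σ k).submatrix e e) ij.1 ij.2 from rfl,
      eval_transportPoly]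
    have hpt : (fun ij : σ × σ =>
        ((((g⁻¹ : GL σ k) : Matrix σ σ k).submatrix e e).submatrix e.symm e.symm) ij.1 ij.2) =
        fun ij : σ × σ => ((g⁻¹ : GL σ k) : Matrix σ σ k) ij.1 ij.2 := by
      funext ij
      simp only [Matrix.submatrix_apply, OrderIso.apply_symm_apply]
    rw [hpt]
  -- count
  calc Module.finrank k (subgroupInvariants W.toRepresentation.dual K)
      = Module.finrank k (LinearMap.range R) := (LinearMap.finrank_range_of_inj hinj).symm
    _ ≤ Module.finrank k (((boundSpace k (χ ∘ e) X).map (pairPoly k (Fin N) D)).map Ev) :=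
        Submodule.finrank_mono hrange
    _ ≤ Module.finrank k ((boundSpace k (χ ∘ e) X).map (pairPoly k (Fin N) D)) :=
        Submodule.finrank_map_le _ _
    _ ≤ Module.finrank k (boundSpace k (χ ∘ e) X) := Submodule.finrank_map_le _ _

/-- **`dim (W^*)^{SL ∩ Stab(det_m)} ≤ g(λ, m × d, m × d)`** (characteristic zero): for
`λ ⊢ m·d` with at most `m²` parts and the `GL_{m²}`-span `W` of a highest-weight vector of weight
`λ*` in `k[Δ_m(f)]` (`f` ANY polynomial on `k^{m×m}`), the `SL_{m²} ∩ Stab(det_m)`-invariant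
vectors of `W^*` span a space of dimension at most the rectangular Kronecker coefficient — the
multiplicity form of the `Q`-side of GCT I Thm. 5.1 for the determinant
(`finrank_subgroupInvariants_dual_le_finrank_boundSpace` with the Borel pairs and
`finrank_boundSpace_kronInvariants_eq_kroneckerCoeff`). BLMW 2011 §5.2 Prop. 5.2.1
(«`mult_π = dim (S_πW)^{H}`», `H ⊇ SL(E) × SL(F)` cut down to its Borel pairs).
[cite: BLMW2011, §5.2 Prop. 5.2.1 (proof)] -/
theorem finrank_subgroupInvariants_dual_detStabilizer_le_kroneckerCoeff [CharZero k] {m d : ℕ}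
    (lam : Nat.Partition (m * d)) (hlam : lam.parts.card ≤ m * m)
    (f : MvPolynomial (MatIdx m) k) {x : OrbitCoordRing f m}
    (hx : x ∈ highestWeightSpace (orbitCoordRep f m)
      ((Weight.dualOfPartition (m * m) lam).toMatIdx : Weight (MatIdx m)))
    (W : Subrepresentation (orbitCoordRep f m))
    (hW : W.toSubmodule =
      Submodule.span k (Set.range fun g : GL (MatIdx m) k => orbitCoordRep f m g x)) :
    Module.finrank k (subgroupInvariants W.toRepresentation.dual
        (slSubgroup (MatIdx m) k ⊓ linStabilizer (detFormLex k m))) ≤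
      kroneckerCoeff k lam (Nat.Partition.rectangle m d) (Nat.Partition.rectangle m d) := by
  have hle := finrank_subgroupInvariants_dual_le_finrank_boundSpace f m
    ((Weight.dualOfPartition (m * m) lam).toMatIdx : Weight (MatIdx m)) (matIdxEquiv m)
    (size_toMatIdx_dualOfPartition m lam hlam) (kronInvariants k m (m * d))
    (IsKronUnimodularBorel k m) (mem_kronInvariants_of_forall k m)
    (slSubgroup (MatIdx m) k ⊓ linStabilizer (detFormLex k m))
    (fun h hh => by
      obtain ⟨a, b, _, ha1, _, hb1, rfl⟩ := hh
      exact reindexGL_kronFin_mem_slSubgroup_inf_linStabilizer_detFormLex k m ha1 hb1)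
    hx W hW
  rwa [toMatIdx_comp_matIdxEquiv, finrank_boundSpace_kronInvariants_eq_kroneckerCoeff k m lam hlam]
    at hle

end Counting

/-! ### §8 The residual number in the evaluator's currency -/

section KronSumCurrency

open TableauEval Literature.RepresentationTheory.FiniteGroups

/-- The sorted parts of the certificate's partition `λ = (13,13,2,2,2,2,2)`. [folklore] -/
private theorem sortedParts_cert1313_lamPartition :
    (cert1313.lamPartition (cert1313.lam_pos_of_verify cert1313_verify)
        (cert1313.lam_sum_of_verify cert1313_verify)).sortedParts = [13, 13, 2, 2, 2, 2, 2] := by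
  rw [Nat.Partition.sortedParts]
  change Multiset.sort (([13, 13, 2, 2, 2, 2, 2] : List ℕ) : Multiset ℕ) (· ≥ ·) = _
  rw [Multiset.coe_sort]
  exact List.mergeSort_eq_self _ (by decide)

/-- The sorted parts of the rectangle `3 × 12`. [folklore] -/
private theorem sortedParts_rectangle_cert1313 :
    (Nat.Partition.rectangle cert1313.m cert1313.d).sortedParts = [12, 12, 12] := by
  rw [Nat.Partition.sortedParts_rectangle _ _ (by decide)]
  decide

/-- **The residual number of §6 in the currency of the tree's verified Murnaghan–Nakayama
evaluator**: `g((13,13,2,2,2,2,2), (12,12,12), (12,12,12)) = 0` iff the class sum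
`MNEval.kronSum 36 [13,13,2,2,2,2,2] [12,12,12] [12,12,12]` (`= 36! · g`,
`factorial_mul_kroneckerCoeff_eq_kronSum`) vanishes — ONE closed integer identity, certifiable by
`decide +kernel` in chunks exactly as `k_3(12)` was (`BI17Ex55KroneckerChunks36*.lean`). No
certificate is claimed here. [cite: FultonHarrisGTM129, Exercise 4.51] -/
theorem kroneckerCoeff_cert1313_eq_zero_iff_kronSum_eq_zero :
    kroneckerCoeff ℂ
        (cert1313.lamPartition (cert1313.lam_pos_of_verify cert1313_verify)
          (cert1313.lam_sum_of_verify cert1313_verify))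
        (Nat.Partition.rectangle cert1313.m cert1313.d)
        (Nat.Partition.rectangle cert1313.m cert1313.d) = 0 ↔
      MNEval.kronSum 36 [13, 13, 2, 2, 2, 2, 2] [12, 12, 12] [12, 12, 12] = 0 := by
  have h := MNEval.factorial_mul_kroneckerCoeff_eq_kronSum
    (cert1313.lamPartition (cert1313.lam_pos_of_verify cert1313_verify)
      (cert1313.lam_sum_of_verify cert1313_verify))
    (Nat.Partition.rectangle cert1313.m cert1313.d) (Nat.Partition.rectangle cert1313.m cert1313.d)
  rw [sortedParts_cert1313_lamPartition, sortedParts_rectangle_cert1313] at h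
  change ((_ : ℕ) : ℤ) = MNEval.kronSum 36 _ _ _ at h
  rw [← h, Nat.cast_eq_zero, Nat.mul_eq_zero, or_iff_right (Nat.factorial_ne_zero _)]

/-- §6's first-criterion module for `(per₃, det₃)`, with its hypothesis in the evaluator's
currency: `MNEval.kronSum 36 [13,13,2,2,2,2,2] [12,12,12] [12,12,12] = 0` ⇒ the `GL₉`-span of
a highest-weight vector of weight `λ*` in `ℂ[Δ(per₃)]₁₂` is irreducible, with `W^*` admissible for
`SL₉ ∩ Stab(per₃)` and not for `SL₉ ∩ Stab(det₃)`.
[cite: MulmuleySohoniSIAM2001, Thm. 5.1 and §5.2 after Ex. 5.2.1 (AV pp.20–22)] -/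
theorem per3Det3_firstCriterionModule_of_kronSum_eq_zero
    (h : MNEval.kronSum 36 [13, 13, 2, 2, 2, 2, 2] [12, 12, 12] [12, 12, 12] = 0) :
    haveI : NeZero cert1313.m := ⟨by decide⟩
    ∃ W : Subrepresentation (orbitCoordRep (paddedPerFormLex ℂ cert1313.n cert1313.m) cert1313.m),
      W.toSubmodule ≤ orbitCoordRingDeg (paddedPerFormLex ℂ cert1313.n cert1313.m) cert1313.m
          cert1313.d ∧
        W.toRepresentation.IsIrreducible ∧
        IsAdmissible W.toRepresentation.dual
          (slSubgroup (MatIdx cert1313.m) ℂ ⊓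
            linStabilizer (paddedPerFormLex ℂ cert1313.n cert1313.m)) ∧
        ¬ IsAdmissible W.toRepresentation.dual
          (slSubgroup (MatIdx cert1313.m) ℂ ⊓ linStabilizer (detFormLex ℂ cert1313.m)) :=
  per3Det3_firstCriterionModule_of_kroneckerCoeff_eq_zero
    (kroneckerCoeff_cert1313_eq_zero_iff_kronSum_eq_zero.mpr h)

/-- `per₃ ∉ Δ(det₃)` by the first criterion of GCT I Thm. 5.1, with the hypothesis in the
evaluator's currency (`MNEval.kronSum 36 [13,13,2,2,2,2,2] [12,12,12] [12,12,12] = 0`).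
[cite: MulmuleySohoniSIAM2001, Thm. 5.1 and Ex. 5.2.1 (AV pp.20–22)] -/
theorem paddedPerFormLex_three_not_mem_orbitClosure_detFormLex_of_kronSum_eq_zero
    (h : MNEval.kronSum 36 [13, 13, 2, 2, 2, 2, 2] [12, 12, 12] [12, 12, 12] = 0) :
    haveI : NeZero cert1313.m := ⟨by decide⟩
    paddedPerFormLex ℂ cert1313.n cert1313.m ∉ orbitClosure (detFormLex ℂ cert1313.m) :=
  paddedPerFormLex_three_not_mem_orbitClosure_detFormLex_of_kroneckerCoeff_eq_zero
    (kroneckerCoeff_cert1313_eq_zero_iff_kronSum_eq_zero.mpr h)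

end KronSumCurrency

end Literature.Computability.AlgebraicComplexity

end
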